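import Literature.Analysis.Calculus.SecondDifferenceBound
import HarnessLib

/-!
# The second forward difference of a PRODUCT of two `C²` real functions: `|Δ_δ²(fg)| ≤ δ²(F₂G₀ + 2F₁G₁ + F₀G₂)`

Topic `Literature/Analysis`; the product form of `SecondDifferenceBound.norm_second_difference_le` (mean value twice), for the lattice symbols that
are products of a radial cutoff and an angular cutoff (the anisotropic sector functions of Benfatto–Giuliani–Mastropietro 2006, §2.5 (2.48):
`F_ω = H(…)·ζ_ω(θ)`; their position-space `L¹` norms are priced by second differences, (2.36aa)).  For real `f, g` with derivatives `f′, f″`, `g′, g″`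
(`HasDerivAt` on `[x, x+2δ]`) bounded by `F₁, F₂`, `G₁, G₂` and values bounded by `F₀, G₀` there:

* `hasDerivAt_mul_deriv2` — `(fg)″ = f″g + 2f′g′ + fg″` in `HasDerivAt` form;
* **`abs_second_difference_mul_le`** — `|(fg)(x+2δ) − 2(fg)(x+δ) + (fg)(x)| ≤ δ²·(F₂G₀ + 2F₁G₁ + F₀G₂)`.

Everything is proved; no definitions, no named facts.

## Sources

G. Benfatto, A. Giuliani, V. Mastropietro, Ann. Henri Poincaré 7 (2006) 809–898, §2.5 (2.48) and (2.36aa) (`BenfattoGiulianiMastropietro2006`).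
-/

noncomputable section

open Set

namespace Literature.Analysis

/-- **Leibniz twice**: if `f′, g′` are derivatives of `f, g` and `f″, g″` of `f′, g′` at `t`, then `t ↦ f′g + fg′` has derivative
`f″g + 2f′g′ + fg″` at `t`. [cite: BenfattoGiulianiMastropietro2006, (2.36aa)] -/
theorem hasDerivAt_mul_deriv2 {f f' f'' g g' g'' : ℝ → ℝ} {t : ℝ} (hf : HasDerivAt f (f' t) t) (hf' : HasDerivAt f' (f'' t) t)
    (hg : HasDerivAt g (g' t) t) (hg' : HasDerivAt g' (g'' t) t) :
    HasDerivAt (fun s => f' s * g s + f s * g' s) (f'' t * g t + 2 * (f' t * g' t) + f t * g'' t) t := by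
  have h := (hf'.mul hg).add (hf.mul hg')
  refine h.congr_deriv ?_
  ring

/-- **The second difference of a product**: on `[x, x+2δ]` (`0 ≤ δ`) let `f, g : ℝ → ℝ` have derivatives `f′, g′`, these derivatives `f″, g″`,
with `|f| ≤ F₀`, `|f′| ≤ F₁`, `|f″| ≤ F₂`, `|g| ≤ G₀`, `|g′| ≤ G₁`, `|g″| ≤ G₂`; then
`|f(x+2δ)g(x+2δ) − 2·f(x+δ)g(x+δ) + f(x)g(x)| ≤ δ²·(F₂G₀ + 2F₁G₁ + F₀G₂)`. [cite: BenfattoGiulianiMastropietro2006, (2.36aa)] -/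
theorem abs_second_difference_mul_le {f f' f'' g g' g'' : ℝ → ℝ} {x δ F₀ F₁ F₂ G₀ G₁ G₂ : ℝ} (hδ : 0 ≤ δ)
    (hf : ∀ t ∈ Icc x (x + 2 * δ), HasDerivAt f (f' t) t) (hf' : ∀ t ∈ Icc x (x + 2 * δ), HasDerivAt f' (f'' t) t)
    (hg : ∀ t ∈ Icc x (x + 2 * δ), HasDerivAt g (g' t) t) (hg' : ∀ t ∈ Icc x (x + 2 * δ), HasDerivAt g' (g'' t) t)
    (bf₀ : ∀ t ∈ Icc x (x + 2 * δ), |f t| ≤ F₀) (bf₁ : ∀ t ∈ Icc x (x + 2 * δ), |f' t| ≤ F₁)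
    (bf₂ : ∀ t ∈ Icc x (x + 2 * δ), |f'' t| ≤ F₂) (bg₀ : ∀ t ∈ Icc x (x + 2 * δ), |g t| ≤ G₀)
    (bg₁ : ∀ t ∈ Icc x (x + 2 * δ), |g' t| ≤ G₁) (bg₂ : ∀ t ∈ Icc x (x + 2 * δ), |g'' t| ≤ G₂) :
    |f (x + 2 * δ) * g (x + 2 * δ) - 2 * (f (x + δ) * g (x + δ)) + f x * g x| ≤ δ ^ 2 * (F₂ * G₀ + 2 * F₁ * G₁ + F₀ * G₂) := by
  have h := norm_second_difference_le (E := ℝ) (f := fun s => f s * g s) (f' := fun s => f' s * g s + f s * g' s)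
    (f'' := fun s => f'' s * g s + 2 * (f' s * g' s) + f s * g'' s) (x := x) (δ := δ) (B := F₂ * G₀ + 2 * F₁ * G₁ + F₀ * G₂) hδ
    (fun t ht => (hf t ht).mul (hg t ht)) (fun t ht => hasDerivAt_mul_deriv2 (hf t ht) (hf' t ht) (hg t ht) (hg' t ht)) ?_
  · simpa only [Real.norm_eq_abs, smul_eq_mul] using h
  · intro t ht
    rw [Real.norm_eq_abs]
    have h0 : 0 ≤ F₀ := (abs_nonneg _).trans (bf₀ t ht)
    have h1 : 0 ≤ F₁ := (abs_nonneg _).trans (bf₁ t ht)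
    calc |f'' t * g t + 2 * (f' t * g' t) + f t * g'' t|
        ≤ |f'' t * g t| + |2 * (f' t * g' t)| + |f t * g'' t| := abs_add_three _ _ _
      _ = |f'' t| * |g t| + 2 * (|f' t| * |g' t|) + |f t| * |g'' t| := by
          rw [abs_mul, abs_mul, abs_mul, abs_mul, abs_two]
      _ ≤ F₂ * G₀ + 2 * (F₁ * G₁) + F₀ * G₂ := by
          refine add_le_add (add_le_add ?_ ?_) ?_
          · exact mul_le_mul (bf₂ t ht) (bg₀ t ht) (abs_nonneg _) ((abs_nonneg _).trans (bf₂ t ht))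
          · exact mul_le_mul_of_nonneg_left (mul_le_mul (bf₁ t ht) (bg₁ t ht) (abs_nonneg _) h1) (by norm_num)
          · exact mul_le_mul (bf₀ t ht) (bg₂ t ht) (abs_nonneg _) h0
      _ = F₂ * G₀ + 2 * F₁ * G₁ + F₀ * G₂ := by ring

end Literature.Analysis

end
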